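import Literature.NumberTheory.Automorphic.AutomorphicTwistNorm
import Literature.NumberTheory.Automorphic.AutomorphicRepLieActionGL
import Literature.NumberTheory.Automorphic.AutomorphicRepsGL
import Literature.NumberTheory.Automorphic.HarishChandraGLEmbeddings
import Literature.NumberTheory.Automorphic.HarishChandraGLTwist
import HarnessLib

/-!
# The archimedean parameter of the twist `π ⊗ |det|_𝔸^s` (Borel–Jacquet model)

Topic `NumberTheory/Automorphic`; theorems only. Companion of `AutomorphicTwistNorm`, which
constructs the twist `π' = π ⊗ |det|_𝔸^s` of an automorphic representation datum
`π = W / W'` of `GL_n(𝔸_K)` (`π'.W = |det|^s · W`, `π'.W' = |det|^s · W'`) and computes its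
Satake parameters (`t_{π',v} = q_v^{-s} t_{π,v}`). Here: its **archimedean (Harish-Chandra)
parameter** — for real `s`, `χ_{π'}(σ) = χ_π(σ) + s` at every complex embedding `σ`
(on the Langlands parameter restricted to `ℂˣ`: `(a_i, b_i) ↦ (a_i + s, b_i + s)`), and so
every infinity type `T` of `π` gives the infinity type `T.twist s` of `π'`
(Borel–Jacquet 1979, 5.7; Buzzard–Gee 2014, §3.1, §5.3). This is the archimedean half of the
normalisation "`π = π₀ ⊗ |det|^s` with `π₀` unitary" (Borel–Jacquet 5.7; Arthur–Clozel 1989,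
Ch. 3, proof of Thm. 3.1; Henniart 2012, §1.18) read on infinity types.

## Contents

* `mixedEmbedding_norm_exp`, `ideleNorm_det_ofInfinite_expGL_eq`,
  `detTwist_ofArch_expMem_of_cpow`, `exists_normExponent` — `|det (exp X, 1)|_𝔸^s = e^{s λ(X)}`
  with the **explicit** real linear form `λ(X) = ∑_{w real} tr X_w + ∑_{w complex} 2 re tr X_w`
  on `𝔤𝔩_n(K_∞)` (the existential `exists_linearMap_detTwist_ofArch_expMem` of
  `AutomorphicTwistNorm`, made explicit: the differential of `|det|_𝔸^s` is needed here, not only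
  its existence).
* `AutomorphicRepData.exists_quotEquiv_of_map_mulChar` — multiplication by the character
  induces `W / W' ≃ W·c / W'·c`.
* `AutomorphicRepData.lieDeriv_mulChar_detTwist_of_cpow`, `AutomorphicRepData.lieRep_mulChar_twist`
  — **the Lie algebra acts on the twist by `X ↦ X + s λ(X)`**: along that isomorphism,
  `π'.lieRep X = ρ X + s λ(X) · 1` for the Lie action `ρ` of `π`
  (`lieDeriv_mulChar_of_exp`: `X (c φ) = c (X φ + s λ(X) φ)`).
* `trace_realPlaceLie`, `trace_complexPlaceLie`, `normExponent_realPlaceLie`,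
  `normExponent_complexPlaceLie` — `λ` on the place factors: `tr Y` at a real place, `2 re tr Y`
  at a complex one; `sum_algHom_apply` — `∑_{τ : 𝕜 →ₐ[ℝ] ℂ} τ(x) = |T| re x`;
  `weightFun_const`.
* `HasHCParameter.of_twist_norm` — on one place factor `𝔤𝔩ₙ(𝕜)`, twisting by the real scalar
  character `Y ↦ s |T| re tr Y` shifts the Harish-Chandra parameter by `s`
  (`HarishChandraGLTwist`: `HasHCParameter.of_add_smul_one` + `.of_conj`).
* `AutomorphicRepData.HasArchParameter.of_map_mulChar_detTwist` — **the archimedean parameter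
  of `π ⊗ |det|_𝔸^s` is `σ ↦ χ_π(σ) + s`** (`s` real);
  `AutomorphicRepData.HasInfinityType.of_map_mulChar_detTwist` — infinity types twist to
  `T.twist s`; `AutomorphicRepData.exists_twist_hasInfinityType` — existence form (`n ≥ 1`,
  with `exists_automorphicRepData_map_mulChar_detTwist` and
  `exists_heckeCharacter_ideleNorm_cpow`).

## References

* A. Borel, H. Jacquet, Corvallis 1979, §4.6 and 5.7. [BorelJacquet1979]
* K. Buzzard, T. Gee (2014), §3.1, §5.3. [BuzzardGee2014]
-/

-- Mathlib idiom (Mathlib/Algebra/Lie/OfAssociative.lean): the commutator bracket on matrices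
attribute [local instance 100] LieRing.ofAssociativeRing

noncomputable section

open scoped MatrixGroups Matrix Classical ComplexConjugate
open NumberField NumberField.InfinitePlace NumberField.mixedEmbedding IsDedekindDomain NormedSpace

namespace Literature.NumberTheory.Automorphic

open Literature.NumberTheory.GaloisRepresentations (HeckeCharacter ideleGroup)

variable {n : ℕ} {K : Type} [Field K] [NumberField K] {hcpt : isCompact_glFiniteIntegralLevel n K}

/-! ### The differential of `|det|_𝔸^s` along `𝔤𝔩_n(K_∞)`, explicitly -/

/-- **`N(exp t) = exp(∑_{w real} t_w + ∑_{w complex} 2 re t_w)`** on the mixed space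
`K_∞ = ℝ^{r₁} × ℂ^{r₂}` (`|e^t| = e^t` at a real place, `|e^z|² = e^{2 re z}` at a complex one).
Explicit form of `exists_linearMap_mixedEmbedding_norm_exp`. [folklore] -/
theorem mixedEmbedding_norm_exp (t : mixedSpace K) :
    mixedEmbedding.norm (exp t) = Real.exp ((∑ w, t.1 w) + ∑ w, 2 * (t.2 w).re) := by
  rw [mixedEmbedding.norm_apply,
    ← Fintype.prod_subtype_mul_prod_subtype (fun w : InfinitePlace K => IsReal w),
    Real.exp_add, Real.exp_sum, Real.exp_sum]
  congr 1
  · refine Finset.prod_congr rfl fun w _ => ?_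
    rw [mult_isReal, pow_one, normAtPlace_apply_of_isReal w.2, Prod.fst_exp, Pi.coe_exp,
      ← Real.exp_eq_exp_ℝ, Real.norm_eq_abs, Real.abs_exp]
  · rw [← (Equiv.subtypeEquivRight (fun w : InfinitePlace K => not_isReal_iff_isComplex)).prod_comp]
    refine Finset.prod_congr rfl fun w _ => ?_
    rw [mult, if_neg w.2, normAtPlace_apply_of_isComplex (not_isReal_iff_isComplex.1 w.2),
      Prod.snd_exp, Pi.coe_exp, ← Complex.exp_eq_exp_ℂ, Complex.norm_exp, ← Real.exp_nat_mul,
      Nat.cast_ofNat, Equiv.subtypeEquivRight_apply]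

/-- **`|det (exp X, 1)|_𝔸 = exp(∑_{w real} tr X_w + ∑_{w complex} 2 re tr X_w)`** for
`X ∈ 𝔤𝔩_n(K_∞)` (`det exp X = exp tr X`). Explicit form of
`exists_linearMap_ideleNorm_det_ofInfinite_expGL`. Borel–Jacquet 1979, 5.7.
[cite: BorelJacquet1979, 5.7] -/
theorem ideleNorm_det_ofInfinite_expGL_eq (X : Matrix (Fin n) (Fin n) (mixedSpace K)) :
    GaloisRepresentations.ideleNorm
        (Matrix.GeneralLinearGroup.det (GLn.ofInfinite n K (expGL X))) =
      Real.exp ((∑ w, X.trace.1 w) + ∑ w, 2 * (X.trace.2 w).re) := by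
  rw [ideleNorm_det_ofInfinite, coe_expGL, Literature.Analysis.Matrix.det_exp_eq_exp_trace,
    mixedEmbedding_norm_exp]

/-- **`|det|^s` on the one-parameter subgroups of `GL_n(K_∞)`**:
`|det (exp X, 1)|_𝔸^s = e^{s λ(X)}`, `λ(X) = ∑_{w real} tr X_w + ∑_{w complex} 2 re tr X_w`, for
the Hecke character `χ = ‖·‖^s`. Borel–Jacquet 1979, 5.7. [cite: BorelJacquet1979, 5.7] -/
theorem detTwist_ofArch_expMem_of_cpow {χ : HeckeCharacter K} {s : ℂ}
    (hχ : ∀ x : ideleGroup K, ((χ x : ℂˣ) : ℂ) = (GaloisRepresentations.ideleNorm x : ℂ) ^ s)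
    (X : (AutomorphyDatum.gl n K hcpt).arch.lie) :
    ((detTwist n χ ((AutomorphyDatum.gl n K hcpt).ofArch
        ((AutomorphyDatum.gl n K hcpt).arch.expMem X)) : ℂˣ) : ℂ) =
      Complex.exp (s * (((∑ w, (X : Matrix (Fin n) (Fin n) (mixedSpace K)).trace.1 w) +
        ∑ w, 2 * ((X : Matrix (Fin n) (Fin n) (mixedSpace K)).trace.2 w).re : ℝ) : ℂ)) := by
  rw [detTwist_apply, hχ, AutomorphyDatum.gl_ofArch_apply, RealMatrixGroup.coe_expMem,
    ideleNorm_det_ofInfinite_expGL_eq, Complex.ofReal_exp,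
    Complex.cpow_def_of_ne_zero (Complex.exp_ne_zero _),
    Complex.log_exp (by rw [Complex.ofReal_im]; exact neg_lt_zero.2 Real.pi_pos)
      (by rw [Complex.ofReal_im]; exact Real.pi_pos.le), mul_comm]

/-- The exponent `λ` as a real linear form on `𝔤 = 𝔤𝔩_n(K_∞)` (it is linear in `X`), packaged
existentially, together with its vanishing on brackets. [folklore] -/
theorem exists_normExponent (hcpt : isCompact_glFiniteIntegralLevel n K) :
    ∃ lam : (AutomorphyDatum.gl n K hcpt).arch.lie →ₗ[ℝ] ℝ,
      (∀ X Y : (AutomorphyDatum.gl n K hcpt).arch.lie, lam ⁅X, Y⁆ = 0) ∧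
      ∀ X : (AutomorphyDatum.gl n K hcpt).arch.lie,
        lam X = (∑ w, (X : Matrix (Fin n) (Fin n) (mixedSpace K)).trace.1 w) +
          ∑ w, 2 * ((X : Matrix (Fin n) (Fin n) (mixedSpace K)).trace.2 w).re := by
  let lam₀ : mixedSpace K →ₗ[ℝ] ℝ :=
    { toFun := fun t => (∑ w, t.1 w) + ∑ w, 2 * (t.2 w).re
      map_add' := fun t u => by
        simp only [Prod.fst_add, Prod.snd_add, Pi.add_apply, Complex.add_re, mul_add,
          Finset.sum_add_distrib]
        ring
      map_smul' := fun r t => by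
        simp only [Prod.smul_fst, Prod.smul_snd, Pi.smul_apply, smul_eq_mul, Complex.real_smul,
          Complex.mul_re, Complex.ofReal_re, Complex.ofReal_im, zero_mul, sub_zero,
          RingHom.id_apply]
        rw [mul_add, Finset.mul_sum, Finset.mul_sum]
        refine congrArg₂ (· + ·) rfl (Finset.sum_congr rfl fun w _ => ?_)
        ring }
  refine ⟨lam₀.comp ((Matrix.traceLinearMap (Fin n) ℝ (mixedSpace K)).comp
      (AutomorphyDatum.gl n K hcpt).arch.lie.toSubmodule.subtype), fun X Y => ?_, fun X => rfl⟩
  change lam₀ (Matrix.trace ((⁅X, Y⁆ : (AutomorphyDatum.gl n K hcpt).arch.lie) :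
    Matrix (Fin n) (Fin n) (mixedSpace K))) = 0
  rw [LieSubalgebra.coe_bracket, LieRing.of_associative_ring_bracket, Matrix.trace_sub,
    Matrix.trace_mul_comm, sub_self, map_zero]

/-! ### `W / W' ≃ W·c / W'·c` and the Lie algebra action on the twist -/

namespace AutomorphicRepData

/-- **Multiplication by a character identifies the quotients**: if `π'.W = c · π.W` and
`π'.W' = c · π.W'` (`mulChar c` is injective), then `φ ↦ c · φ` induces a linear isomorphism
`W / W' ≃ W·c / W'·c` carrying `[φ]` to `[c · φ]`. Borel–Jacquet 1979, 4.6. [folklore] -/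
theorem exists_quotEquiv_of_map_mulChar (c : (AdelicGroupData.gl n K).Adelic →* ℂˣ)
    {π π' : AutomorphicRepData (AutomorphyDatum.gl n K hcpt)}
    (hW : π'.W = π.W.map (mulChar c)) (hW' : π'.W' = π.W'.map (mulChar c)) :
    ∃ e : π.Quot ≃ₗ[ℂ] π'.Quot, ∀ φ : π.W,
      e (π.mkQ φ) = π'.mkQ ⟨mulChar c φ, hW ▸ Submodule.mem_map_of_mem φ.2⟩ := by
  obtain ⟨e₁, he₁⟩ : ∃ e₁ : π.W ≃ₗ[ℂ] π'.W,
      ∀ φ : π.W, ((e₁ φ : π'.W) : (AdelicGroupData.gl n K).Adelic → ℂ) = mulChar c φ :=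
    ⟨(Submodule.equivMapOfInjective (mulChar c) (mulChar_injective c) π.W).trans
      (LinearEquiv.ofEq _ _ hW.symm), fun φ => rfl⟩
  have hker : π.kerQuot.map (e₁ : π.W →ₗ[ℂ] π'.W) = π'.kerQuot := by
    ext ψ
    simp only [Submodule.mem_map, AutomorphicRepData.kerQuot, Submodule.mem_comap,
      Submodule.subtype_apply, LinearEquiv.coe_coe]
    constructor
    · rintro ⟨φ, hφ, rfl⟩
      rw [he₁, hW']
      exact Submodule.mem_map_of_mem hφ
    · intro hψ
      rw [hW', Submodule.mem_map] at hψ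
      obtain ⟨φ₀, hφ₀, hφ₀ψ⟩ := hψ
      refine ⟨⟨φ₀, π.lt.le hφ₀⟩, hφ₀, Subtype.ext ?_⟩
      rw [he₁]
      exact hφ₀ψ
  refine ⟨Submodule.Quotient.equiv π.kerQuot π'.kerQuot e₁ hker, fun φ => ?_⟩
  have h2 : (e₁ : π.W →ₗ[ℂ] π'.W) φ = ⟨mulChar c φ, hW ▸ Submodule.mem_map_of_mem φ.2⟩ :=
    Subtype.ext (he₁ φ)
  have h3 : Submodule.Quotient.equiv π.kerQuot π'.kerQuot e₁ hker (Submodule.Quotient.mk φ) =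
      Submodule.Quotient.mk ((e₁ : π.W →ₗ[ℂ] π'.W) φ) :=
    rfl
  calc _ = Submodule.Quotient.mk ((e₁ : π.W →ₗ[ℂ] π'.W) φ) := h3
    _ = _ := by rw [h2]; rfl

end AutomorphicRepData

/-- `|det (exp Y, 1)|_𝔸^s = exp((s · λ) Y)` with `λ` the exponent of `exists_normExponent`, in the
form consumed by `ArchimedeanCharacterTwist` (`δ = s · λ` as a complex linear form).
[cite: BorelJacquet1979, 5.7] -/
theorem detTwist_ofArch_expMem_eq_exp_smul {χ : HeckeCharacter K} {s : ℂ}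
    (hχ : ∀ x : ideleGroup K, ((χ x : ℂˣ) : ℂ) = (GaloisRepresentations.ideleNorm x : ℂ) ^ s)
    {lam : (AutomorphyDatum.gl n K hcpt).arch.lie →ₗ[ℝ] ℝ}
    (hlam : ∀ X : (AutomorphyDatum.gl n K hcpt).arch.lie,
      lam X = (∑ w, (X : Matrix (Fin n) (Fin n) (mixedSpace K)).trace.1 w) +
        ∑ w, 2 * ((X : Matrix (Fin n) (Fin n) (mixedSpace K)).trace.2 w).re)
    (Y : (AutomorphyDatum.gl n K hcpt).arch.lie) :
    ((detTwist n χ ((AutomorphyDatum.gl n K hcpt).ofArch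
        ((AutomorphyDatum.gl n K hcpt).arch.expMem Y)) : ℂˣ) : ℂ) =
      Complex.exp ((s • (Complex.ofRealAm.toLinearMap.comp lam)) Y) := by
  rw [detTwist_ofArch_expMem_of_cpow hχ, ← hlam Y]
  rfl

/-- **`X (|det|^s · φ) = |det|^s · (X φ + s λ(X) φ)`** for a form `φ` of an automorphic
representation of `GL_n(𝔸_K)` (`lieDeriv_mulChar_of_exp` with the differential `s λ` of
`|det|_𝔸^s`). Borel–Jacquet 1979, §1.5 and 5.7. [cite: BorelJacquet1979, 5.7] -/
theorem AutomorphicRepData.lieDeriv_mulChar_detTwist_of_cpow {χ : HeckeCharacter K} {s : ℂ}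
    (hχ : ∀ x : ideleGroup K, ((χ x : ℂˣ) : ℂ) = (GaloisRepresentations.ideleNorm x : ℂ) ^ s)
    {lam : (AutomorphyDatum.gl n K hcpt).arch.lie →ₗ[ℝ] ℝ}
    (hlam : ∀ X : (AutomorphyDatum.gl n K hcpt).arch.lie,
      lam X = (∑ w, (X : Matrix (Fin n) (Fin n) (mixedSpace K)).trace.1 w) +
        ∑ w, 2 * ((X : Matrix (Fin n) (Fin n) (mixedSpace K)).trace.2 w).re)
    (π : AutomorphicRepData (AutomorphyDatum.gl n K hcpt))
    (X : (AutomorphyDatum.gl n K hcpt).arch.lie) (φ : π.W) :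
    lieDeriv (AutomorphyDatum.gl n K hcpt).ofArch X
        (mulChar (detTwist n χ) (φ : (AdelicGroupData.gl n K).Adelic → ℂ)) =
      mulChar (detTwist n χ) ((π.lieDerivW X φ + (s * (lam X : ℂ)) • φ : π.W) :
        (AdelicGroupData.gl n K).Adelic → ℂ) := by
  haveI : FiniteDimensional ℝ (mixedSpace K) := inferInstance
  rw [lieDeriv_mulChar_of_exp _ (detTwist_ofArch_expMem_eq_exp_smul hχ hlam) X
    (π.isArchSmooth_of_mem_W φ.2)]
  rfl

namespace AutomorphicRepData

/-- **The Lie algebra acts on the twist `π ⊗ |det|^s` by `X ↦ X + s λ(X)`**: for the twisted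
datum `π'` (`π'.W = |det|^s · W`), the quotient isomorphism `e` of
`exists_quotEquiv_of_map_mulChar`, the Lie action `ρ` of `π` and the exponent `λ` of
`exists_normExponent`, `π'.lieRep X (e v) = e (ρ X v + s λ(X) v)` — since
`X (|det|^s φ) = |det|^s (X φ + s λ(X) φ)` (`lieDeriv_mulChar_detTwist_of_cpow`).
Borel–Jacquet 1979, §1.5, 4.6 and 5.7. [cite: BorelJacquet1979, 5.7] -/
theorem lieRep_mulChar_twist {χ : HeckeCharacter K} {s : ℂ}
    (hχ : ∀ x : ideleGroup K, ((χ x : ℂˣ) : ℂ) = (GaloisRepresentations.ideleNorm x : ℂ) ^ s)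
    {π π' : AutomorphicRepData (AutomorphyDatum.gl n K hcpt)}
    (hW : π'.W = π.W.map (mulChar (detTwist n χ)))
    {e : π.Quot ≃ₗ[ℂ] π'.Quot}
    (he : ∀ φ : π.W,
      e (π.mkQ φ) = π'.mkQ ⟨mulChar (detTwist n χ) φ, hW ▸ Submodule.mem_map_of_mem φ.2⟩)
    {ρ : (AutomorphyDatum.gl n K hcpt).arch.lie →ₗ⁅ℝ⁆ Module.End ℂ π.Quot} (hρ : π.HasLieAction ρ)
    {lam : (AutomorphyDatum.gl n K hcpt).arch.lie →ₗ[ℝ] ℝ}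
    (hlam : ∀ X : (AutomorphyDatum.gl n K hcpt).arch.lie,
      lam X = (∑ w, (X : Matrix (Fin n) (Fin n) (mixedSpace K)).trace.1 w) +
        ∑ w, 2 * ((X : Matrix (Fin n) (Fin n) (mixedSpace K)).trace.2 w).re)
    (X : (AutomorphyDatum.gl n K hcpt).arch.lie) (v : π.Quot) :
    π'.lieRep X (e v) = e (ρ X v + (s * (lam X : ℂ)) • v) := by
  induction v using Submodule.Quotient.induction_on with
  | H φ =>
  have hmk : (Submodule.Quotient.mk φ : π.Quot) = π.mkQ φ := rfl
  have hmem : ∀ ψ : π.W, mulChar (detTwist n χ) ψ ∈ π'.W := fun ψ =>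
    hW ▸ Submodule.mem_map_of_mem ψ.2
  -- left-hand side: `[X (c φ)]`
  have hL : π'.lieRep X (e (π.mkQ φ)) =
      π'.mkQ (π'.lieDerivW X ⟨mulChar (detTwist n χ) φ, hmem φ⟩) := by
    rw [he]
    exact π'.lieRep_mkQ X _
  -- right-hand side: `[c (X φ + s λ(X) φ)]`
  have h5 : ρ X (π.mkQ φ) + (s * (lam X : ℂ)) • π.mkQ φ =
      π.mkQ (π.lieDerivW X φ + (s * (lam X : ℂ)) • φ) := by
    rw [hρ X φ, (π.mkQ).map_add, (π.mkQ).map_smul]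
  rw [hmk, hL, h5, he]
  congr 1
  exact Subtype.ext (lieDeriv_mulChar_detTwist_of_cpow hχ hlam π X φ)

end AutomorphicRepData

/-! ### The exponent `λ` on the place factors, and sums over the embeddings -/

section Places

omit [NumberField K] in
/-- `tr (ι_w Y) = (δ_w tr Y, 0)` for the inclusion `ι_w : 𝔤𝔩ₙ(ℝ) ↪ 𝔤𝔩ₙ(K_∞)` of a real place.
[folklore] -/
theorem trace_realPlaceLie (w : {w : InfinitePlace K // IsReal w}) (Y : Matrix (Fin n) (Fin n) ℝ) :
    (realPlaceLie n w Y).trace = (Pi.single w Y.trace, 0) := by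
  refine Prod.ext ?_ ?_
  · funext w'
    simp only [Matrix.trace, Matrix.diag_apply, realPlaceLie_apply, Prod.fst_sum, Finset.sum_apply,
      Pi.single_apply]
    split_ifs <;> simp
  · simp only [Matrix.trace, Matrix.diag_apply, realPlaceLie_apply, Prod.snd_sum, Finset.sum_const_zero]

omit [NumberField K] in
/-- `tr (ι_w Y) = (0, δ_w tr Y)` for the inclusion `ι_w : 𝔤𝔩ₙ(ℂ) ↪ 𝔤𝔩ₙ(K_∞)` of a complex
place. [folklore] -/
theorem trace_complexPlaceLie (w : {w : InfinitePlace K // IsComplex w})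
    (Y : Matrix (Fin n) (Fin n) ℂ) :
    (complexPlaceLie n w Y).trace = (0, Pi.single w Y.trace) := by
  refine Prod.ext ?_ ?_
  · simp only [Matrix.trace, Matrix.diag_apply, complexPlaceLie_apply, Prod.fst_sum,
      Finset.sum_const_zero]
  · funext w'
    simp only [Matrix.trace, Matrix.diag_apply, complexPlaceLie_apply, Prod.snd_sum, Finset.sum_apply,
      Pi.single_apply]
    split_ifs <;> simp

/-- **`λ(ι_w Y) = tr Y` at a real place.** [folklore] -/
theorem normExponent_realPlaceLie (w : {w : InfinitePlace K // IsReal w})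
    (Y : Matrix (Fin n) (Fin n) ℝ) :
    ((∑ w', (realPlaceLie n w Y).trace.1 w') + ∑ w', 2 * ((realPlaceLie n w Y).trace.2 w').re) =
      Y.trace := by
  rw [trace_realPlaceLie]
  simp only [Fintype.sum_pi_single', Pi.zero_apply, Complex.zero_re, mul_zero,
    Finset.sum_const_zero, add_zero]

/-- **`λ(ι_w Y) = 2 re tr Y` at a complex place.** [folklore] -/
theorem normExponent_complexPlaceLie (w : {w : InfinitePlace K // IsComplex w})
    (Y : Matrix (Fin n) (Fin n) ℂ) :
    ((∑ w', (complexPlaceLie n w Y).trace.1 w') +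
      ∑ w', 2 * ((complexPlaceLie n w Y).trace.2 w').re) = 2 * Y.trace.re := by
  rw [trace_complexPlaceLie]
  simp only [Pi.zero_apply, Finset.sum_const_zero, zero_add]
  rw [show (fun w' => 2 * (Pi.single (M := fun _ => ℂ) w Y.trace w').re) =
      fun w' => Pi.single (M := fun _ => ℝ) w (2 * Y.trace.re) w' from ?_, Fintype.sum_pi_single']
  funext w'
  by_cases h : w' = w
  · subst h; simp
  · simp [Pi.single_eq_of_ne h]

end Places

section Embeddings

variable {𝕜 : Type*} [RCLike 𝕜]

/-- **`∑_{τ : 𝕜 →ₐ[ℝ] ℂ} τ(x) = |T| · re x`** (`= x` for `𝕜 = ℝ`, `= x + x̄ = 2 re x` for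
`𝕜 = ℂ`): `τ(x) = re x + im x · τ(I)` and `∑_τ τ(I) = 0` (`HCEmb.sum_algHom_I`). [folklore] -/
theorem sum_algHom_apply (x : 𝕜) :
    ∑ τ : 𝕜 →ₐ[ℝ] ℂ, τ x = (Fintype.card (𝕜 →ₐ[ℝ] ℂ) : ℂ) * ((RCLike.re x : ℝ) : ℂ) := by
  have hx : ∀ τ : 𝕜 →ₐ[ℝ] ℂ, τ x = ((RCLike.re x : ℝ) : ℂ) + ((RCLike.im x : ℝ) : ℂ) * τ RCLike.I :=
    fun τ => by
      conv_lhs => rw [← RCLike.re_add_im x]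
      rw [map_add, map_mul, ← RCLike.algebraMap_eq_ofReal, AlgHom.commutes, AlgHom.commutes]
      rfl
  simp only [hx, Finset.sum_add_distrib, Finset.sum_const, Finset.card_univ, nsmul_eq_mul,
    ← Finset.mul_sum, HCEmb.sum_algHom_I, mul_zero, add_zero]

/-- **The weight of the scalar character `Y ↦ s |T| re tr Y`**:
`∑_τ ∑_i s τ(h_i) = s |T| re (∑_i h_i)` — the hypothesis `hδc` of
`HasHCParameter.of_add_smul_one` for the differential of `|det|_w^s` (`|T| = 1` at a real place,
`2` at a complex one). [folklore] -/
theorem weightFun_const (s : ℂ) (h : Fin n → 𝕜) :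
    weightFun (fun (_ : 𝕜 →ₐ[ℝ] ℂ) (_ : Fin n) => s) h =
      s * ((Fintype.card (𝕜 →ₐ[ℝ] ℂ) : ℂ) * ((RCLike.re (∑ i, h i) : ℝ) : ℂ)) := by
  simp only [weightFun, ← Finset.mul_sum]
  rw [Finset.sum_comm]
  simp only [sum_algHom_apply, ← Finset.mul_sum, map_sum, Complex.ofReal_sum]

end Embeddings

/-! ### Harish-Chandra parameters under the twist by `|det|_w^s` on one place factor -/

section PlaceTwist

variable {𝕜 : Type*} [RCLike 𝕜] {V V' : Type*} [AddCommGroup V] [Module ℂ V] [AddCommGroup V']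
  [Module ℂ V']

/-- **The twist by the norm character on one place factor shifts the Harish-Chandra parameter by
`s`.** Let `𝕜 = ℝ` or `ℂ` and suppose `ρ'` on `V'` is, along `e : V ≃ V'`, the twist of `ρ` by
the real scalar character `Y ↦ s |T| re tr Y` of `𝔤𝔩ₙ(𝕜)` (`|T| = #(𝕜 →ₐ[ℝ] ℂ)`: `s tr Y` for
`𝕜 = ℝ`, `2 s re tr Y` for `𝕜 = ℂ` — the differential of `|det|_w^s`). Then a Harish-Chandra
parameter `χ` of `(V, ρ)` gives the parameter `τ ↦ χ τ + s` of `(V', ρ')`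
(`HasHCParameter.of_add_smul_one` + `HasHCParameter.of_conj`). Borel–Jacquet 1979, 5.7;
Knapp 2002, Thm. 5.44. [cite: BorelJacquet1979, 5.7] -/
theorem HasHCParameter.of_twist_norm (s : ℝ) (e : V ≃ₗ[ℂ] V')
    {ρ : Matrix (Fin n) (Fin n) 𝕜 →ₗ⁅ℝ⁆ Module.End ℂ V}
    {ρ' : Matrix (Fin n) (Fin n) 𝕜 →ₗ⁅ℝ⁆ Module.End ℂ V'}
    (hrel : ∀ (Y : Matrix (Fin n) (Fin n) 𝕜) (v : V), ρ' Y (e v) =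
      e (ρ Y v + ((s * ((Fintype.card (𝕜 →ₐ[ℝ] ℂ) : ℝ) * RCLike.re Y.trace) : ℝ) : ℂ) • v))
    {χ : (𝕜 →ₐ[ℝ] ℂ) → Multiset ℂ} (hχ : HasHCParameter ρ χ) :
    HasHCParameter ρ' fun τ => (χ τ).map (· + (s : ℂ)) := by
  -- the real scalar character `δ(Y) = s |T| re tr Y`
  let δ : Matrix (Fin n) (Fin n) 𝕜 →ₗ[ℝ] ℝ :=
    (s * (Fintype.card (𝕜 →ₐ[ℝ] ℂ) : ℝ)) • (RCLike.reLm.comp (Matrix.traceLinearMap (Fin n) ℝ 𝕜))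
  have hδapply : ∀ Y, δ Y = s * ((Fintype.card (𝕜 →ₐ[ℝ] ℂ) : ℝ) * RCLike.re Y.trace) := fun Y => by
    simp only [δ, LinearMap.smul_apply, LinearMap.comp_apply, Matrix.traceLinearMap_apply,
      RCLike.reLm_coe, smul_eq_mul]
    ring
  have hδ : ∀ Y Y' : Matrix (Fin n) (Fin n) 𝕜, δ ⁅Y, Y'⁆ = 0 := fun Y Y' => by
    rw [hδapply, LieRing.of_associative_ring_bracket, Matrix.trace_sub, Matrix.trace_mul_comm,
      sub_self, map_zero, mul_zero, mul_zero]
  have hδn : ∀ Y ∈ upperNilpLie 𝕜 n, δ Y = 0 := fun Y hY => by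
    have hY' : ∀ i j : Fin n, j ≤ i → Y i j = 0 := hY
    have htr : Y.trace = 0 := Finset.sum_eq_zero fun i _ => hY' i i le_rfl
    rw [hδapply, htr, map_zero, mul_zero, mul_zero]
  have hδc : ∀ h : Fin n → 𝕜, ((δ (Matrix.diagonal h) : ℝ) : ℂ) =
      weightFun (fun (_ : 𝕜 →ₐ[ℝ] ℂ) (_ : Fin n) => (s : ℂ)) h := fun h => by
    rw [hδapply, weightFun_const, Matrix.trace_diagonal]
    push_cast
    ring
  obtain ⟨ρδ, hρδ⟩ := exists_lieHom_add_real_smul_one ρ δ hδ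
  have h1 : HasHCParameter ρδ fun τ => (χ τ).map (· + (s : ℂ)) :=
    HasHCParameter.of_add_smul_one hδ hδn hδc hρδ hχ
  refine HasHCParameter.of_conj e (fun Y v => ?_) h1
  rw [hrel, hρδ, LinearMap.add_apply, LinearMap.smul_apply, Module.End.one_apply, hδapply]

end PlaceTwist

/-! ### The archimedean parameter of `π ⊗ |det|_𝔸^s` -/

namespace AutomorphicRepData

/-- **The archimedean parameter of the twist `π' = π ⊗ |det|_𝔸^s`, `s ∈ ℝ`**: if `π = W / W'`
has archimedean parameter `χ_∞` then the twisted datum (`π'.W = |det|^s · W`,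
`π'.W' = |det|^s · W'`, `AutomorphicTwistNorm.exists_automorphicRepData_map_mulChar_detTwist`)
has archimedean parameter `σ ↦ χ_∞(σ) + s` — every Harish-Chandra entry at every complex
embedding shifted by `s` (`(a_i, b_i) ↦ (a_i + s, b_i + s)` on `ℂˣ ⊆ W_{K_w}`). Proof: the Lie
algebra acts on `π'` by `X ↦ X + s λ(X)` along `W/W' ≃ W·c/W'·c` (`lieRep_mulChar_twist`), and on
the factor at a place `w` the character `s λ ∘ ι_w` is `s tr` (real `w`) or `2 s re tr`
(complex `w`), which shifts the Harish-Chandra parameter by `s` (`HasHCParameter.of_twist_norm`).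
Borel–Jacquet 1979, 5.7; Buzzard–Gee 2014, §3.1 and §5.3. [cite: BorelJacquet1979, 5.7] -/
theorem HasArchParameter.of_map_mulChar_detTwist {χ : HeckeCharacter K} {s : ℝ}
    (hχ : ∀ x : ideleGroup K,
      ((χ x : ℂˣ) : ℂ) = (GaloisRepresentations.ideleNorm x : ℂ) ^ ((s : ℝ) : ℂ))
    {π π' : AutomorphicRepData (AutomorphyDatum.gl n K hcpt)}
    (hW : π'.W = π.W.map (mulChar (detTwist n χ))) (hW' : π'.W' = π.W'.map (mulChar (detTwist n χ)))
    {χ₀ : (K →+* ℂ) → Multiset ℂ} (h : π.HasArchParameter χ₀) :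
    π'.HasArchParameter fun σ => (χ₀ σ).map (· + (s : ℂ)) := by
  obtain ⟨ρ, hρ, hreal, hcx⟩ := h
  obtain ⟨e, he⟩ := exists_quotEquiv_of_map_mulChar (detTwist n χ) hW hW'
  obtain ⟨lam, -, hlam⟩ := exists_normExponent hcpt
  have hrel := fun X v => lieRep_mulChar_twist hχ hW he hρ hlam X v
  refine ⟨π'.lieRep, π'.hasLieAction_lieRep, fun w => ?_, fun w => ?_⟩
  · -- real place: `s λ(ι_w Y) = s tr Y = s |T| re tr Y` with `|T| = 1`
    refine HasHCParameter.of_twist_norm (𝕜 := ℝ) s e (fun Y v => ?_) (hreal w)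
    have key : ∀ X : (AutomorphyDatum.gl n K hcpt).arch.lie,
        (X : Matrix (Fin n) (Fin n) (mixedSpace K)) = realPlaceLie n w Y →
          (s : ℂ) * ((lam X : ℝ) : ℂ) =
            ((s * ((Fintype.card (ℝ →ₐ[ℝ] ℂ) : ℝ) * RCLike.re Y.trace) : ℝ) : ℂ) := by
      intro X hX
      rw [hlam, hX, normExponent_realPlaceLie, HCEmb.card_algHom_of_I_eq_zero (𝕜 := ℝ) (by simp),
        Nat.cast_one, one_mul, RCLike.re_to_real, Complex.ofReal_mul]
    simp only [LieHom.comp_apply]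
    rw [hrel, key _ rfl]
  · -- complex place: `s λ(ι_w Y) = 2 s re tr Y = s |T| re tr Y` with `|T| = 2`
    refine HasHCParameter.of_twist_norm (𝕜 := ℂ) s e (fun Y v => ?_) (hcx w)
    have key : ∀ X : (AutomorphyDatum.gl n K hcpt).arch.lie,
        (X : Matrix (Fin n) (Fin n) (mixedSpace K)) = complexPlaceLie n w Y →
          (s : ℂ) * ((lam X : ℝ) : ℂ) =
            ((s * ((Fintype.card (ℂ →ₐ[ℝ] ℂ) : ℝ) * RCLike.re Y.trace) : ℝ) : ℂ) := by
      intro X hX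
      rw [hlam, hX, normExponent_complexPlaceLie, HCEmb.card_algHom_of_im_I (𝕜 := ℂ) (by simp),
        Nat.cast_ofNat, RCLike.re_eq_complex_re]
      push_cast
      ring
    simp only [LieHom.comp_apply]
    rw [hrel, key _ rfl]

/-- **Infinity types of the twist**: an infinity type `T` of `π` gives the infinity type
`T.twist s : σ ↦ {(a + s, b + s)}` of `π ⊗ |det|_𝔸^s` (Buzzard–Gee 2014, §3.1, §5.3: this is
how `C`-algebraic becomes `L`-algebraic after the twist by `|det|^{(n-1)/2}`).
[cite: BuzzardGee2014, §3.1 and Definition 5.3.3] -/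
theorem HasInfinityType.of_map_mulChar_detTwist {χ : HeckeCharacter K} {s : ℝ}
    (hχ : ∀ x : ideleGroup K,
      ((χ x : ℂˣ) : ℂ) = (GaloisRepresentations.ideleNorm x : ℂ) ^ ((s : ℝ) : ℂ))
    {π π' : AutomorphicRepData (AutomorphyDatum.gl n K hcpt)}
    (hW : π'.W = π.W.map (mulChar (detTwist n χ))) (hW' : π'.W' = π.W'.map (mulChar (detTwist n χ)))
    {T : InfinityType K n} (hT : π.HasInfinityType T) : π'.HasInfinityType (T.twist s) := by
  refine ⟨⟨fun σ => by rw [InfinityType.twist_apply, Multiset.card_map, hT.1.1 σ], fun σ => ?_⟩, ?_⟩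
  · rw [InfinityType.twist_apply, InfinityType.twist_apply, hT.1.2 σ, Multiset.map_map,
      Multiset.map_map]
    rfl
  · have h := HasArchParameter.of_map_mulChar_detTwist hχ hW hW' hT.2
    have e : (fun σ => ((T σ).map ArchWeight.a).map (· + (s : ℂ))) =
        fun σ => (T.twist s σ).map ArchWeight.a := by
      funext σ
      rw [InfinityType.twist_apply, Multiset.map_map, Multiset.map_map]
      rfl
    rw [← e]
    exact h

/-- **Existence form** (`n ≥ 1`): every automorphic representation datum `π` of `GL_n(𝔸_K)`
with an infinity type `T` has, for every real `s`, a twist `π ⊗ |det|_𝔸^s` — a datum `π'` with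
`π'.W = |det|^s · W` — whose infinity type is `T.twist s` (and whose Satake parameters are
`q_v^{-s} t_{π,v}`, `AutomorphicTwistNorm`). Borel–Jacquet 1979, 5.7.
[cite: BorelJacquet1979, 5.7] -/
theorem exists_twist_hasInfinityType [NeZero n] (π : AutomorphicRepData (AutomorphyDatum.gl n K hcpt))
    (s : ℝ) {T : InfinityType K n} (hT : π.HasInfinityType T) :
    ∃ (χ : HeckeCharacter K) (π' : AutomorphicRepData (AutomorphyDatum.gl n K hcpt)),
      (∀ x : ideleGroup K,
        ((χ x : ℂˣ) : ℂ) = (GaloisRepresentations.ideleNorm x : ℂ) ^ ((s : ℝ) : ℂ)) ∧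
      π'.W = π.W.map (mulChar (detTwist n χ)) ∧ π'.W' = π.W'.map (mulChar (detTwist n χ)) ∧
      π'.HasInfinityType (T.twist s) := by
  obtain ⟨χ, hχ⟩ := exists_heckeCharacter_ideleNorm_cpow (K := K) ((s : ℝ) : ℂ)
  obtain ⟨π', hW, hW'⟩ := exists_automorphicRepData_map_mulChar_detTwist hχ π
  exact ⟨χ, π', hχ, hW, hW', HasInfinityType.of_map_mulChar_detTwist hχ hW hW' hT⟩

end AutomorphicRepData

end Literature.NumberTheory.Automorphic
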